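import Summits.BirchSwinnertonDyer.BirchSwinnertonDyer.Theses.KatoDescentPotSupersingular
import Summits.BirchSwinnertonDyer.Rank1Residual.O6.X3WildOfKMCTorsionFreeMember
import HarnessLib

/-!
# Route `KatoDescentPotSupersingular` (rung K9, cell `bsd-potss`): the declared residual `WildRankOne`
# (item stmt-BirchSwinnertonDyer-19200) FROM KMC₃ ⊕ PR^× at the 3-torsion-free members, over the
# image-free readings — the route's rank-one DescentGlue (a `--supports … --as helper` file)

Route.md, two-layer plan: "WildRankOne ⇐ (KMC₃) → (Perrin-Riou up to unit, `Additive.PerrinRiouUpToUnitAt`)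
→ (kernel descent …); re-type the residual as `KMCThree → PRUnitThree → WildRankOne`". The tree theorem
`O6.wildRankOne_of_kmc_perrinRiou_torsionFree` (seat kmc part 10, p408212; verbatim the residual's shape)
is that glue: Kato's Main Conjecture 12.10 and the Perrin-Riou / Burns–Kurihara–Sano Conj. 1.5 reading up
to a unit at ONE `3`-torsion-free member `W'` of the class (such a member exists: Mazur–Kenku walk,
`Addv.exists_torsionFree_member`) give `MissingPPartAt W 3` in analytic rank one, over part 8a's readings
(`TorsionFree.DescentCountReading`, `TorsionFree.RankOneCountReading` = BKS19 Thm. 7.3 with Hyp. 2.2 (i) =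
`t_W = 0`, `TorsionFree.RealizableOfKMC`), the interface lemma `ReadsTrivialKMC`, and the published facts
Cassels, GZK, modularity, Mazur–Kenku. This file restates it with the ROUTE DECL as its type. CONDITIONAL
(audit `proof.conditional`); the item is NOT closed. Seat `bsd-potss-kmc` generation 6.

References: [Kato2004Asterisque] Conj. 12.10 (p. 224), §14.14 (p. 243), Prop. 14.16 (p. 244);
[BurnsKuriharaSano2019] Conj. 1.5, Thm. 7.3, Thm. 7.6; [SilvermanAEC2009] IX.6 Ex. 6.4.
-/

set_option autoImplicit false
-- sibling precedent (`KatoDescentPotSupersingularAssembly.lean`): the directory name repeats the summit name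
set_option linter.dupNamespace false

noncomputable section

open scoped Classical

namespace Summit.BirchSwinnertonDyer.BirchSwinnertonDyer.Theorems

open WeierstrassCurve Literature.NumberTheory.EllipticCurves
  Literature.NumberTheory.EllipticCurves.Rank1Residual
  Literature.NumberTheory.EllipticCurves.Rank1Residual.Typed
  Summit.BirchSwinnertonDyer.Rank1Residual.Additive
  Summit.BirchSwinnertonDyer.Rank1Residual
  Summit.BirchSwinnertonDyer.BirchSwinnertonDyer.Theses.KatoDescentPotSupersingular

variable {IsOf : ∀ (W : WeierstrassCurve ℚ) [W.IsElliptic] [W.IsGloballyMinimal] (p : ℕ) [Fact p.Prime],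
  KatoDescentDatum p → Prop}
variable {PRRatio : ∀ (W : WeierstrassCurve ℚ) [W.IsElliptic] [W.IsGloballyMinimal] (p : ℕ)
  [Fact p.Prime], ℚ_[p] → Prop}
variable {KMC : ∀ (W : WeierstrassCurve ℚ) [W.IsElliptic] [W.IsGloballyMinimal] (p : ℕ), Prop}

/-- **Rank-one DescentGlue for the K9 residual `WildRankOne`**: KMC₃ ⊕ PR^× at the `3`-torsion-free
members of each wild class (hypothesis `hK`), over the image-free readings, Cassels, GZK, modularity and
Mazur–Kenku ⟹ `WildRankOne` (type = the route decl verbatim), by `O6.wildRankOne_of_kmc_perrinRiou_torsionFree`.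
Conditional over displayed hypotheses; nothing about Kato's objects or Perrin-Riou's conjecture is
asserted; the item is not closed. [cite: Kato2004Asterisque, Conj. 12.10 (p. 224), §14.14 (p. 243), Prop. 14.16 (2) (p. 244)]
[cite: BurnsKuriharaSano2019, Conj. 1.5, Thm. 7.3 (p. 29)] [cite: SilvermanAEC2009, IX.6 Example 6.4] -/
theorem wildRankOne_of_kmc_perrinRiou_torsionFree (hR : TorsionFree.DescentCountReading IsOf)
    (hC : TorsionFree.RankOneCountReading IsOf PRRatio) (hreal : TorsionFree.RealizableOfKMC IsOf KMC)
    (hread : ReadsTrivialKMC IsOf KMC) (hCassels : bsdRHS_eq_of_isIsogenous)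
    (hGZK : rank_eq_analyticRank_of_analyticRank_le_one) (hmod : hasEntireLFunction_rat)
    (hMK : mazurKenku_exists_cyclic_isogeny)
    (hK : ∀ (W W' : WeierstrassCurve ℚ) [W.IsElliptic] [W.IsGloballyMinimal] [W'.IsElliptic]
      [W'.IsGloballyMinimal],
      W.analyticRank = 1 → ClassO6 W 3 → IsIsogenous W W' → Addv W' 3 → 0 ≤ padicValRat 3 W'.j →
        ¬ 3 ∣ W'.torsionOrder → KMC W' 3 ∧ PerrinRiouUpToUnitAt PRRatio W' 3) :
    Summit.BirchSwinnertonDyer.BirchSwinnertonDyer.Theses.KatoDescentPotSupersingular.WildRankOne :=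
  fun W _ _ _ hr hO ↦ O6.wildRankOne_of_kmc_perrinRiou_torsionFree hR hC hreal hread hCassels hGZK hmod hMK hK W hr hO

end Summit.BirchSwinnertonDyer.BirchSwinnertonDyer.Theorems

end
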